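import Summits.QuantumFields.YangMills.Theorems.UnitScaleTiltProp8HalvingQuarterMatrix
import Summits.QuantumFields.YangMills.Theorems.UnitScaleTiltProp8FlatCubeQContraction
import HarnessLib

/-!
# Route `UnitScaleTilt`, crux K1 child «MinimiserStabilityRegPr» (stmt-QuantumFields-19200), registered stub V2′ `stub_halvingStep`
# (skeletons v8 5b4e846794b80374 / v10 `BirthV10`) — **THE FAR SIZE (155) OF THE DATUM FROM THE (152)-SIZE OF THE CHART FIELD**: if the `𝔤`-valued datum is the
# LINEARISED CONSTRAINT of the chart field, `B = QA′` ([Balaban1985Variational] (157) «LʲηQ_jA′ = B on Λ′_j», in the tree's normalisation `Q = QE D`), then the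
# weighted sup size `(L^{j(b)}η)‖A′(b)‖ ≤ r` of (152) gives `‖B(c)‖ ≤ L·r·L^{k−j(c)}` at EVERY index bond `c` — the `(155)-far` clause of the analytic package of
# `HalvingAssembly.H_of_package` with `C₂ε₀ := L·r` — by p1 g16's sup-contraction of the averaging `FlatCubeQContraction.qContrLetter_of_adm22` read through the
# real functionals of the matrices (duality, `HalvingQuarterMatrix.norm_le_of_forall_reFunctional`)

Cell `ym3-torus` (HUMAN RULING D-0037, YM ladder rung R3 — continuum SU(2) YM₃ on the torus is a RUNG, not the Clay problem), width seat
`ym-ust-19200-w3` gen 2 (D-0149).  `--supports stmt-QuantumFields-19200 --as helper`; def-free, 0 sorry, standard axioms.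

THE PRINT ([Balaban1985Variational] p. 301–302): *«Lʲη|A|, (Lʲη)²|∇^ηA|, (Lʲη)³|∂^{η*}∂^ηA|, (Lʲη)³|Δ^ηA| < 9dL²B₁Mε₀ on Ω′_j, j = 0, 1, …, k; (152) … K₁ = e^{iB̃}
with |B̃| < 18d²L³Mε₀, (155) … Q_j(ηA) = B on Λ′_j … or simply Q(ηA) = B. (156) … The configuration A′ satisfies (152) with 36 instead of 9 on the right-hand
side … LʲηQ_jA′ = B on Λ′_j (157)»* — the datum is the (linearised) average of the chart field, and the averaging does not increase sup norms
([Balaban1984PropagatorsI] (1.18): `(Q_kA)_b` is an average of `A` over straight contours with equal weights).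

WHAT THIS FILE PROVES (no definition, no sorry):
* §1 `reFunctional_kernelQ` — for the matrix-valued average `B(c) = Σ_b (Qe_b)(c)·A′(b)` (kernel of `FlatOpsLettersAssembly.Qfun D`) and every real reading
  `g(M) = r′·Re(u·f(M))`: `g(B(c)) = (Qfun D (g ∘ A′))(c)`.
* §2 **`weighted_norm_Q_le`** — the `𝔤`-valued sup-contraction: `QContrLetter F n K D w C_Q` and `∀ b, w₁(b)‖A′(b)‖ ≤ r` give
  `(L^{j(c)}η)‖B(c)‖ ≤ C_Q·r` at every index bond; **`far_of_weighted152`** — for an admissible family (`Adm22 D R M`, `R·M ≥ 2L`, `D.k = K − n`; in particular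
  the cube sequence `cubeSeqMT3` of the package, `FlatCubeSequenceAdm.adm22_cubeSeqMT3`) and the P2 level weights: `‖B(c)‖ ≤ L·r·L^{(K−n)−j(c)}` at EVERY index bond
  `c` — the `(155)-far` clause of the package verbatim with `C₂·ε₀ := L·r` (and, at the top level, the crude near bound `‖B(c)‖ ≤ L·r`, which the halving does NOT use:
  there (160) gives the `ε₁`-size, `HalvingDatum160`).
HONEST SCOPE: the (152)-size of `A′` and the identification `B = QA′` ((156)–(157)) are hypotheses (pillar P1, [Balaban1985RegularSpaces] Thm 2 (1.37) on the cube
sequence, and P3a's change of variables); bookkeeping only.  NOT a claim about the crux, the rung, or the mass gap.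

References: T. Bałaban, CMP **102** (1985) 277–309 [Balaban1985Variational] (152) p.301, (155)–(157) p.302; CMP **95** (1984) 17–40 [Balaban1984PropagatorsI] (1.18) p.20;
CMP **96** (1984) 223–250 [Balaban1984PropagatorsII] (2.2) p.224, (2.20) p.226.
-/

set_option autoImplicit false

noncomputable section

open scoped BigOperators Matrix.Norms.L2Operator

namespace Summit.QuantumFields.YangMills.Theorems.HalvingFarDatum

open Literature.MathematicalPhysics.QuantumFieldTheory.Balaban1983to89
open B6SectADomainsV1 (Domains)
open B6SectAOperatorsV1 (BondIdx)
open T3ContinuumYM3Torus (T3Family)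
open FlatCubeOpsText (Adm22 IsLevWeight)
open FlatCubeSequenceAligned (cubeSeqMT3)
open FlatCubeSequenceAdm (adm22_cubeSeqMT3)
open FlatOpsLettersAssembly (Qfun QContrLetter levWeight_nonneg)
open FlatCubeQContraction (qContrLetter_of_adm22)
open HalvingQuarterMatrix (norm_le_of_forall_reFunctional)

/-! ## §1 A real reading of the matrix-valued average is the average of the read field -/

section Kernel

variable {P : Params} {D : Domains P}

/-- **`g(QA′(c)) = (Q(g ∘ A′))(c)`** for the matrix-valued average written through the kernel of `Qfun D` (`e_b` the indicator of the fine bond `b`) and the reading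
`g(M) = r′·Re(u·f(M))`. [cite: Balaban1984PropagatorsII, (2.20) p.226] -/
theorem reFunctional_kernelQ {A' : PBond P 0 → Matrix (Fin 2) (Fin 2) ℂ} {B : BondIdx D → Matrix (Fin 2) (Fin 2) ℂ}
    (hB : ∀ c, B c = ∑ b, Qfun D (Pi.single b 1) c • A' b)
    (f : StrongDual ℂ (Matrix (Fin 2) (Fin 2) ℂ)) (u : ℂ) (r : ℝ) (c : BondIdx D) :
    r * (u * f (B c)).re = Qfun D (fun b => r * (u * f (A' b)).re) c := by
  have hX : (fun b => r * (u * f (A' b)).re) = ∑ b, (r * (u * f (A' b)).re) • (Pi.single b (1 : ℝ) : PBond P 0 → ℝ) := by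
    funext b'
    rw [Finset.sum_apply, Finset.sum_eq_single b' (fun b _ hb => by simp [Ne.symm hb]) (fun h => absurd (Finset.mem_univ _) h)]
    simp
  have hR : Qfun D (fun b => r * (u * f (A' b)).re) c = ∑ b, (r * (u * f (A' b)).re) * Qfun D (Pi.single b 1) c := by
    rw [hX, map_sum, Finset.sum_apply]
    refine Finset.sum_congr rfl fun b _ => ?_
    rw [LinearMap.map_smul, Pi.smul_apply, smul_eq_mul]
  have hL : f (B c) = ∑ b, ((Qfun D (Pi.single b 1) c : ℝ) : ℂ) * f (A' b) := by
    rw [hB c, map_sum]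
    refine Finset.sum_congr rfl fun b _ => ?_
    rw [ContinuousLinearMap.map_smul_of_tower, Complex.real_smul]
  rw [hR, hL, Finset.mul_sum, Complex.re_sum, Finset.mul_sum]
  refine Finset.sum_congr rfl fun b _ => ?_
  rw [mul_left_comm u, Complex.re_ofReal_mul]
  ring

end Kernel

/-! ## §2 The sup-contraction for the `𝔤`-valued field and the far clause of the package -/

section Far

variable {F : T3Family} {n K : ℕ} {D : Domains (F.P K)}

/-- **THE `𝔤`-VALUED SUP-CONTRACTION OF `Q`**: `QContrLetter F n K D w C_Q` (`0 ≤ C_Q`) and the weighted size `w₁(b)‖A′(b)‖ ≤ r` give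
`(L^{j(c)}η)·‖(QA′)(c)‖ ≤ C_Q·r` at every index bond (every real reading of `A′` obeys the same weighted size; duality). [cite: Balaban1984PropagatorsI, (1.18) p.20;
Balaban1984PropagatorsII, (2.20) p.226] -/
theorem weighted_norm_Q_le {w : ℕ → PBond (F.P K) 0 → ℝ} {CQ r : ℝ} (hQ : QContrLetter F n K D w CQ) (hCQ : 0 ≤ CQ)
    (hw0 : ∀ b, 0 ≤ w 1 b) {A' : PBond (F.P K) 0 → Matrix (Fin 2) (Fin 2) ℂ} {B : BondIdx D → Matrix (Fin 2) (Fin 2) ℂ}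
    (hB : ∀ c, B c = ∑ b, Qfun D (Pi.single b 1) c • A' b) (hA' : ∀ b, w 1 b * ‖A' b‖ ≤ r) (c : BondIdx D) :
    ((F.L : ℝ) ^ ((c.1.1 : ℕ)) * ((F.L : ℝ)⁻¹) ^ (K - n)) * ‖B c‖ ≤ CQ * r := by
  have hL0 : (0 : ℝ) < (F.L : ℝ) := by exact_mod_cast lt_trans zero_lt_one F.hL.2
  have hω : 0 < (F.L : ℝ) ^ ((c.1.1 : ℕ)) * ((F.L : ℝ)⁻¹) ^ (K - n) := by positivity
  have hr : 0 ≤ r := by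
    obtain ⟨b⟩ : Nonempty (PBond (F.P K) 0) := ⟨⟨fun _ => 0, ⟨0, lt_of_lt_of_le zero_lt_one (F.P K).hd⟩⟩⟩
    exact le_trans (mul_nonneg (hw0 b) (norm_nonneg _)) (hA' b)
  rw [← le_div_iff₀' hω]
  refine norm_le_of_forall_reFunctional (B c) (div_nonneg (mul_nonneg hCQ hr) hω.le) fun f u r' hg => ?_
  rw [reFunctional_kernelQ hB f u r' c, le_div_iff₀' hω]
  have hX : ∀ b, w 1 b * |r' * (u * f (A' b)).re| ≤ r := fun b =>
    (mul_le_mul_of_nonneg_left (hg (A' b)) (hw0 b)).trans (hA' b)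
  exact (mul_le_mul_of_nonneg_left (le_abs_self _) hω.le).trans (hQ _ r hr hX c)

/-- **(152) ⇒ (155)-far AT EVERY ADMISSIBLE FAMILY**: `Adm22 D R M` with `R·M ≥ 2L`, `D.k = K − n`, the P2 level weights `w`, the `𝔤`-valued datum `B = QA′` and the weighted
size `w₁(b)‖A′(b)‖ ≤ r` give `‖B(c)‖ ≤ L·r·L^{(K−n)−j(c)}` at every index bond `c` (`C_Q = L` by `FlatCubeQContraction.qContrLetter_of_adm22`) — the far clause of the
package of `HalvingAssembly.H_of_package` with `C₂ε₀ := L·r`. [cite: Balaban1985Variational, (152) p.301, (155)-(157) p.302; Balaban1984PropagatorsII, (2.2) p.224] -/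
theorem far_of_weighted152 (hDk : D.k = K - n) {R M : ℕ} (hAdm : Adm22 D R M) (hRM : 2 * F.L ≤ R * M) {w : ℕ → PBond (F.P K) 0 → ℝ}
    (hw : IsLevWeight F n K D w) {r : ℝ} {A' : PBond (F.P K) 0 → Matrix (Fin 2) (Fin 2) ℂ} {B : BondIdx D → Matrix (Fin 2) (Fin 2) ℂ}
    (hB : ∀ c, B c = ∑ b, Qfun D (Pi.single b 1) c • A' b) (hA' : ∀ b, w 1 b * ‖A' b‖ ≤ r) (c : BondIdx D) :
    ‖B c‖ ≤ (F.L : ℝ) * r * (F.L : ℝ) ^ ((K - n) - (c.1.1 : ℕ)) := by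
  have hL0 : (0 : ℝ) < (F.L : ℝ) := by exact_mod_cast lt_trans zero_lt_one F.hL.2
  have h := weighted_norm_Q_le (qContrLetter_of_adm22 F n K D hDk hAdm hRM w hw) hL0.le (levWeight_nonneg hw 1) hB hA' c
  have hjk : (c.1.1 : ℕ) ≤ K - n := by
    have h1 : (c.1.1 : ℕ) < D.k + 1 := c.1.1.isLt
    omega
  -- `L^{j}·L^{−k} = (L^{k−j})⁻¹`
  obtain ⟨i, hi⟩ : ∃ i, K - n = (c.1.1 : ℕ) + i := ⟨K - n - (c.1.1 : ℕ), by omega⟩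
  have hpow : (F.L : ℝ) ^ ((c.1.1 : ℕ)) * ((F.L : ℝ)⁻¹) ^ (K - n) = ((F.L : ℝ) ^ i)⁻¹ := by
    rw [hi, inv_pow, pow_add, mul_inv, ← mul_assoc, mul_inv_cancel₀ (pow_ne_zero _ hL0.ne'), one_mul]
  have hki : (K - n) - (c.1.1 : ℕ) = i := by omega
  rw [hpow] at h
  rw [hki]
  have hLi : (0 : ℝ) < (F.L : ℝ) ^ i := by positivity
  rw [inv_mul_le_iff₀ hLi] at h
  linarith

/-- **THE FAR CLAUSE OF THE PACKAGE AT THE CUBE SEQUENCE**: for `D := cubeSeqMT3 F n K x ρ S M` with `R·M ≤ S`, `2L ≤ R·M`, `1 ≤ K − n`, the P2 level weights and a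
`𝔤`-valued chart field `A′` of weighted (152)-size `r`: the datum `B = QA′` has `‖B(c)‖ ≤ (L·r)·L^{(K−n)−j(c)}` on every index bond below the top level
(the shape of the package's far clause; the level restriction is not used).
[cite: Balaban1985Variational, (152) p.301, (155)-(157) p.302] -/
theorem far_cubeSeqMT3 (x : Site (F.P K) 0) (ρ S M : ℕ) (hM : 1 ≤ M) {R : ℕ} (hRS : R * M ≤ S) (hRM : 2 * F.L ≤ R * M)
    {w : ℕ → PBond (F.P K) 0 → ℝ} (hw : IsLevWeight F n K (cubeSeqMT3 F n K x ρ S M hM) w) {r : ℝ}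
    {A' : PBond (F.P K) 0 → Matrix (Fin 2) (Fin 2) ℂ} {B : BondIdx (cubeSeqMT3 F n K x ρ S M hM) → Matrix (Fin 2) (Fin 2) ℂ}
    (hB : ∀ c, B c = ∑ b, Qfun (cubeSeqMT3 F n K x ρ S M hM) (Pi.single b 1) c • A' b) (hA' : ∀ b, w 1 b * ‖A' b‖ ≤ r) :
    ∀ c : BondIdx (cubeSeqMT3 F n K x ρ S M hM), (c.1.1 : ℕ) < K - n →
      ‖B c‖ ≤ ((F.L : ℝ) * r) * (F.L : ℝ) ^ ((K - n) - (c.1.1 : ℕ)) := by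
  intro c _
  exact far_of_weighted152 rfl (adm22_cubeSeqMT3 F n K x ρ hM hRS) hRM hw hB hA' c

end Far

end Summit.QuantumFields.YangMills.Theorems.HalvingFarDatum

end
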